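import Mathlib
import HarnessLib
import Literature.MathematicalPhysics.QuantumLattice.HubbardInteractionKernels

/-!
# K3 gen-8-FLOW (stmt 20437, stub (C), located risk «(C)-B-REP» item (β), step 2 input): the BARE Hubbard vertex at the loop strings of the two-leg
# response — `F₄[V_U]((K,σ,+),(K,σ,−),(A.1, 1−A.2), A) = [A.1.2 ≠ σ]·(±1)·U/(βL²)³·(4!)⁻¹`, independent of `K` and of `A`'s frequency–momentum

Cell gate-hubbard-kl, seat p2 g12.  The loop term of the covariance-response door at the reading string `X_{(K,σ)}` is `6·Σ_A Ċ(A,Ā)·𝒲₄(X_{(K,σ)}, Ā, A)`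
(`…EngineFrameShiftMomentResponse.covResp_moment_kernel_two_laplacian_le`).  Its first-order part has `𝒲₄ = F₄[V_U]`, the plain quartic kernel of the
on-site interaction, which at these strings is a SIGN times `U/(βL²)³/4!` when the fixed pair `Ā, A` has the opposite spin and ZERO when it has the same
spin — in particular it does not depend on `K` nor on `A`'s frequency–momentum, so the bare loop is `±(U/(2(βL²)³))·Σ_{(ω,q)} ṡ((ω,q), σ̄)`: a SIGNED
symbol sum (read by `…EngineFrameShiftDensityResponse.norm_sum_uvSymbolCT_sub_le_signed`).

* `kernel_hubbardInteraction_readingString_of_spin_eq` — same spin: `0` (two columns of the delta matrix against every vertex monomial vanish);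
* `kernel_hubbardInteraction_readingString_up_one/_up_zero/_down_one/_down_zero` — the four opposite-spin strings, values `±U/(βL²)³·(4!)⁻¹`
  (permutations `1`, `swap 2 3`, `(02)(13)`, `(02)(13)·swap` of `vertexLegs`);
* **`norm_kernel_hubbardInteraction_readingString_le`** — `‖F₄[V_U](X)‖ ≤ |U|/|βL²|³/24` at every such string.

Proofs only; no definitions.  References: BGM 2006 §2.1 (2.6a) [cite: BenfattoGiulianiMastropietro2006]; Salmhofer 1999 §4.3 (4.95).
-/

noncomputable section

namespace Summit.HubbardSuperconductivity.HubbardSuperconductivity.Theorems.EngineV8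

set_option linter.dupNamespace false -- summit = problem name (single-conjunct summit), D-0017

open Finset Literature.MathematicalPhysics.QuantumLattice Literature.Probability.LatticeModels GrassmannAlgebra

variable {L M : ℕ} [NeZero L]

/-- **Same spin: the bare vertex does not see the string** — if `A.1.2 = σ` then `F₄[V_U]((K,σ,+),(K,σ,−),Ā,A) = 0`. -/
theorem kernel_hubbardInteraction_readingString_of_spin_eq (β U : ℝ) (K : FreqMomentum L M) (σ : Fin 2) (A : HubbardFieldIdx L M)
    (hA : A.1.2 = σ) :
    kernel ℂ (hubbardInteraction L M β U) 4
      (Fin.snoc (Fin.snoc ![(((K, σ), 0) : HubbardFieldIdx L M), ((K, σ), 1)] (A.1, 1 - A.2) : Fin 3 → HubbardFieldIdx L M) A) = 0 := by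
  classical
  set X : Fin 4 → HubbardFieldIdx L M :=
    Fin.snoc (Fin.snoc ![(((K, σ), 0) : HubbardFieldIdx L M), ((K, σ), 1)] (A.1, 1 - A.2) : Fin 3 → HubbardFieldIdx L M) A with hX
  -- every leg of the string has spin `σ`
  have hspin : ∀ i : Fin 4, (X i).1.2 = σ := by
    intro i
    fin_cases i
    · rfl
    · rfl
    · show ((A.1, 1 - A.2) : HubbardFieldIdx L M).1.2 = σ; exact hA
    · show A.1.2 = σ; exact hA
  rw [hubbardInteraction_eq_sum_smul, kernel_sum]
  refine sum_eq_zero fun κ _ => ?_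
  rw [kernel_smul, vertexMonomial_eq_genProd, kernel_genProd]
  -- the column of the leg of `vertexLegs κ` with the other spin vanishes
  have hcol : ∃ j : Fin 4, ∀ i : Fin 4, deltaMatrix ℂ X (vertexLegs L M κ) i j = 0 := by
    fin_cases σ
    · refine ⟨2, fun i => ?_⟩
      rw [deltaMatrix_apply, if_neg]
      intro h
      have := congrArg (fun Z : HubbardFieldIdx L M => Z.1.2) h
      rw [hspin i] at this
      simp [vertexLegs] at this
    · refine ⟨0, fun i => ?_⟩
      rw [deltaMatrix_apply, if_neg]
      intro h
      have := congrArg (fun Z : HubbardFieldIdx L M => Z.1.2) h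
      rw [hspin i] at this
      simp [vertexLegs] at this
  obtain ⟨j, hj⟩ := hcol
  rw [Matrix.det_eq_zero_of_column_eq_zero j hj, mul_zero, mul_zero]

omit [NeZero L] in
/-- The conservation constraint holds for the momenta `(K, K, p, p)`. -/
theorem vertexConserving_pair (K p : FreqMomentum L M) : vertexConserving L M ![K, K, p, p] := by
  simp [vertexConserving]

/-- **Opposite spin, `σ = ↑`, `A = (p,↓,−)`**: the string IS `vertexLegs (K,K,p,p)`; value `+U/(βL²)³·(4!)⁻¹`. -/
theorem kernel_hubbardInteraction_readingString_up_one (β U : ℝ) (K p : FreqMomentum L M) :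
    kernel ℂ (hubbardInteraction L M β U) 4
      (Fin.snoc (Fin.snoc ![(((K, (0 : Fin 2)), 0) : HubbardFieldIdx L M), ((K, 0), 1)] ((p, 1), 1 - 1) : Fin 3 → HubbardFieldIdx L M)
        (((p, 1), 1) : HubbardFieldIdx L M)) =
      (((U / (β * (L : ℝ) ^ 2) ^ 3 : ℝ)) : ℂ) * (((4 : ℕ).factorial : ℚ)⁻¹ • (1 : ℂ)) := by
  have hX : (Fin.snoc (Fin.snoc ![(((K, (0 : Fin 2)), 0) : HubbardFieldIdx L M), ((K, 0), 1)] ((p, 1), 1 - 1) : Fin 3 → HubbardFieldIdx L M)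
      (((p, 1), 1) : HubbardFieldIdx L M)) = vertexLegs L M ![K, K, p, p] := by
    funext i; fin_cases i <;> rfl
  rw [hX, kernel_hubbardInteraction_vertexLegs, if_pos (vertexConserving_pair K p)]

/-- **Opposite spin, `σ = ↑`, `A = (p,↓,+)`**: the string is `vertexLegs (K,K,p,p) ∘ swap 2 3`; value `−U/(βL²)³·(4!)⁻¹`. -/
theorem kernel_hubbardInteraction_readingString_up_zero (β U : ℝ) (K p : FreqMomentum L M) :
    kernel ℂ (hubbardInteraction L M β U) 4
      (Fin.snoc (Fin.snoc ![(((K, (0 : Fin 2)), 0) : HubbardFieldIdx L M), ((K, 0), 1)] ((p, 1), 1 - 0) : Fin 3 → HubbardFieldIdx L M)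
        (((p, 1), 0) : HubbardFieldIdx L M)) =
      -((((U / (β * (L : ℝ) ^ 2) ^ 3 : ℝ)) : ℂ) * (((4 : ℕ).factorial : ℚ)⁻¹ • (1 : ℂ))) := by
  have hX : (Fin.snoc (Fin.snoc ![(((K, (0 : Fin 2)), 0) : HubbardFieldIdx L M), ((K, 0), 1)] ((p, 1), 1 - 0) : Fin 3 → HubbardFieldIdx L M)
      (((p, 1), 0) : HubbardFieldIdx L M)) = vertexLegs L M ![K, K, p, p] ∘ (Equiv.swap (2 : Fin 4) 3) := by
    funext i; fin_cases i <;> rfl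
  rw [hX, kernel_hubbardInteraction_vertexLegs_comp_perm, if_pos (vertexConserving_pair K p), Equiv.Perm.sign_swap (by decide)]
  push_cast
  ring

/-- **Opposite spin, `σ = ↓`, `A = (p,↑,−)`**: the string is `vertexLegs (p,p,K,K) ∘ (02)(13)`; value `+U/(βL²)³·(4!)⁻¹`. -/
theorem kernel_hubbardInteraction_readingString_down_one (β U : ℝ) (K p : FreqMomentum L M) :
    kernel ℂ (hubbardInteraction L M β U) 4
      (Fin.snoc (Fin.snoc ![(((K, (1 : Fin 2)), 0) : HubbardFieldIdx L M), ((K, 1), 1)] ((p, 0), 1 - 1) : Fin 3 → HubbardFieldIdx L M)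
        (((p, 0), 1) : HubbardFieldIdx L M)) =
      (((U / (β * (L : ℝ) ^ 2) ^ 3 : ℝ)) : ℂ) * (((4 : ℕ).factorial : ℚ)⁻¹ • (1 : ℂ)) := by
  have hX : (Fin.snoc (Fin.snoc ![(((K, (1 : Fin 2)), 0) : HubbardFieldIdx L M), ((K, 1), 1)] ((p, 0), 1 - 1) : Fin 3 → HubbardFieldIdx L M)
      (((p, 0), 1) : HubbardFieldIdx L M)) = vertexLegs L M ![p, p, K, K] ∘ (Equiv.swap (0 : Fin 4) 2 * Equiv.swap (1 : Fin 4) 3) := by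
    funext i; fin_cases i <;> rfl
  rw [hX, kernel_hubbardInteraction_vertexLegs_comp_perm, if_pos (vertexConserving_pair p K), Equiv.Perm.sign_mul,
    Equiv.Perm.sign_swap (by decide), Equiv.Perm.sign_swap (by decide)]
  push_cast
  ring

/-- **Opposite spin, `σ = ↓`, `A = (p,↑,+)`**: the string is `vertexLegs (p,p,K,K) ∘ (02)(13)·swap`; value `−U/(βL²)³·(4!)⁻¹`. -/
theorem kernel_hubbardInteraction_readingString_down_zero (β U : ℝ) (K p : FreqMomentum L M) :
    kernel ℂ (hubbardInteraction L M β U) 4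
      (Fin.snoc (Fin.snoc ![(((K, (1 : Fin 2)), 0) : HubbardFieldIdx L M), ((K, 1), 1)] ((p, 0), 1 - 0) : Fin 3 → HubbardFieldIdx L M)
        (((p, 0), 0) : HubbardFieldIdx L M)) =
      -((((U / (β * (L : ℝ) ^ 2) ^ 3 : ℝ)) : ℂ) * (((4 : ℕ).factorial : ℚ)⁻¹ • (1 : ℂ))) := by
  have hX : (Fin.snoc (Fin.snoc ![(((K, (1 : Fin 2)), 0) : HubbardFieldIdx L M), ((K, 1), 1)] ((p, 0), 1 - 0) : Fin 3 → HubbardFieldIdx L M)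
      (((p, 0), 0) : HubbardFieldIdx L M)) =
        vertexLegs L M ![p, p, K, K] ∘ (Equiv.swap (0 : Fin 4) 2 * Equiv.swap (1 : Fin 4) 3 * Equiv.swap (2 : Fin 4) 3) := by
    funext i; fin_cases i <;> rfl
  rw [hX, kernel_hubbardInteraction_vertexLegs_comp_perm, if_pos (vertexConserving_pair p K), Equiv.Perm.sign_mul, Equiv.Perm.sign_mul,
    Equiv.Perm.sign_swap (by decide), Equiv.Perm.sign_swap (by decide), Equiv.Perm.sign_swap (by decide)]
  push_cast
  ring

/-- **The bare vertex at every loop string of the reading response is bounded by `|U|/|βL²|³/24`** — and takes only the values `0`, `±U/(βL²)³/24`. -/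
theorem norm_kernel_hubbardInteraction_readingString_le (β U : ℝ) (K : FreqMomentum L M) (σ : Fin 2) (A : HubbardFieldIdx L M) :
    ‖kernel ℂ (hubbardInteraction L M β U) 4
        (Fin.snoc (Fin.snoc ![(((K, σ), 0) : HubbardFieldIdx L M), ((K, σ), 1)] (A.1, 1 - A.2) : Fin 3 → HubbardFieldIdx L M) A)‖ ≤
      |U| / |β * (L : ℝ) ^ 2| ^ 3 / 24 := by
  have hval : ‖((((U / (β * (L : ℝ) ^ 2) ^ 3 : ℝ)) : ℂ) * (((4 : ℕ).factorial : ℚ)⁻¹ • (1 : ℂ)))‖ = |U| / |β * (L : ℝ) ^ 2| ^ 3 / 24 := by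
    rw [norm_mul, Complex.norm_real, Real.norm_eq_abs, abs_div, abs_pow]
    norm_num [Nat.factorial]
    ring
  obtain ⟨⟨p, τ⟩, c⟩ := A
  by_cases hτ : τ = σ
  · rw [kernel_hubbardInteraction_readingString_of_spin_eq β U K σ ((p, τ), c) hτ, norm_zero]
    positivity
  · -- opposite spin: four explicit cases
    fin_cases σ <;> fin_cases τ <;> first | exact absurd rfl hτ | skip
    · fin_cases c
      · show ‖kernel ℂ (hubbardInteraction L M β U) 4 (Fin.snoc (Fin.snoc ![(((K, (0 : Fin 2)), 0) : HubbardFieldIdx L M), ((K, 0), 1)]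
          ((p, 1), 1 - 0) : Fin 3 → HubbardFieldIdx L M) (((p, 1), 0) : HubbardFieldIdx L M))‖ ≤ _
        rw [kernel_hubbardInteraction_readingString_up_zero, norm_neg, hval]
      · show ‖kernel ℂ (hubbardInteraction L M β U) 4 (Fin.snoc (Fin.snoc ![(((K, (0 : Fin 2)), 0) : HubbardFieldIdx L M), ((K, 0), 1)]
          ((p, 1), 1 - 1) : Fin 3 → HubbardFieldIdx L M) (((p, 1), 1) : HubbardFieldIdx L M))‖ ≤ _
        rw [kernel_hubbardInteraction_readingString_up_one, hval]
    · fin_cases c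
      · show ‖kernel ℂ (hubbardInteraction L M β U) 4 (Fin.snoc (Fin.snoc ![(((K, (1 : Fin 2)), 0) : HubbardFieldIdx L M), ((K, 1), 1)]
          ((p, 0), 1 - 0) : Fin 3 → HubbardFieldIdx L M) (((p, 0), 0) : HubbardFieldIdx L M))‖ ≤ _
        rw [kernel_hubbardInteraction_readingString_down_zero, norm_neg, hval]
      · show ‖kernel ℂ (hubbardInteraction L M β U) 4 (Fin.snoc (Fin.snoc ![(((K, (1 : Fin 2)), 0) : HubbardFieldIdx L M), ((K, 1), 1)]
          ((p, 0), 1 - 1) : Fin 3 → HubbardFieldIdx L M) (((p, 0), 1) : HubbardFieldIdx L M))‖ ≤ _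
        rw [kernel_hubbardInteraction_readingString_down_one, hval]

end Summit.HubbardSuperconductivity.HubbardSuperconductivity.Theorems.EngineV8

end
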